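import Summits.BirchSwinnertonDyer.BirchSwinnertonDyer.Theorems.KatoDescentTamePotSupersingularTameFineSelmerTrivialDoorAway
import HarnessLib

/-!
# Route `KatoDescentTamePotSupersingular` (rung K8, sub-rung B4 (t′), cell `bsd-potss`): the Selmer-trivial (A)-door on rows with TWO
# multiplicative bad primes `q₁, q₂` — (c3) from `Δ_min ∣ p^a · q₁^c₁ · q₂^c₂ · c₄^b`, `E(ℚ_p)[p] = 0` and the two displayed clauses
# (seat `bsd-potss-k8t-c4` g27; `--supports stmt-BirchSwinnertonDyer-19982 --as helper`; closes nothing)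

HONEST FRAMING. THEOREMS ONLY; nothing is booked; BSD / (A) proved for no class of curves. Two-prime twin of `…TameFineSelmerTrivialDoorAway`
(this seat, p749398) for the one KT row of the (A)@5 table with two multiplicative bad primes (`434400l1`: `q₁ = 3`, `q₂ = 181`, both NON-split
with `#E(ℚ_q)[5] = 1` observed, conjA-anchor g25 KT-MULT-PLACES). The clauses at `q₁`, `q₂` are DISPLAYED binders; a displayed clause that is
numerically false makes a record vacuous (see the erratum of `…TameFineSelmerTrivialRecords03`) — users must check it against the census.

References: [CoatesSujatha2005] §3 statement (A); [DeoRaySujatha2023] Thm. 3.9 (c3); [SilvermanAEC2009] VII.5.1, VII.6.1–6.2; [Miller2011LMS] Def. 1.1.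
-/

set_option autoImplicit false
set_option linter.dupNamespace false

noncomputable section

open scoped Classical NumberField
open WeierstrassCurve NumberField IsDedekindDomain IsDedekindDomain.HeightOneSpectrum Rat.HeightOneSpectrum Field
  Literature.NumberTheory.EllipticCurves Literature.NumberTheory.EllipticCurves.GreenbergSelmer
  Literature.NumberTheory.EllipticCurves.Rank1Residual Literature.NumberTheory.EllipticCurves.Rank1Residual.Typed
  Summit.BirchSwinnertonDyer.BirchSwinnertonDyer.Rank1Residual.IntModel

namespace Summit.BirchSwinnertonDyer.BirchSwinnertonDyer.Theorems.TameFineSelmerTrivialRoad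

variable (W : WeierstrassCurve ℚ) [W.IsElliptic] [W.IsGloballyMinimal]

/-- **The (c3) clauses away from `p` from `Δ_min ∣ p^a · q₁^c₁ · q₂^c₂ · c₄^b` and the clauses at `q₁`, `q₂`** (`p ≥ 5`, `W` globally minimal):
a bad `ℓ ∉ {p, q₁, q₂}` divides `c₄`, hence is additive (`E[p^∞]^{I_ℓ} = 0`, Literature p745700). [cite: SilvermanAEC2009, VII.5 Prop. 5.1 (a), (c)
and Thm. VII.6.1 with Cor. VII.6.2] [cite: DeoRaySujatha2023, §3 Thm. 3.9 (c3)] -/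
theorem hbad_of_dvd_pow_mul_pow_mul_pow_mul_pow {p : ℕ} [Fact p.Prime] (hp5 : 5 ≤ p) {q₁ q₂ : ℕ} (hq₁ : q₁.Prime) (hq₂ : q₂.Prime)
    {a b c₁ c₂ : ℕ} (hrad : minimalDiscriminantInt W ∣ (p : ℤ) ^ a * (q₁ : ℤ) ^ c₁ * (q₂ : ℤ) ^ c₂ * (integralModelInt W).c₄ ^ b)
    (hq₁c : ∀ v : HeightOneSpectrum (𝓞 ℚ), ((q₁ : ℕ) : 𝓞 ℚ) ∈ v.asIdeal →
      ∀ x : W.geomPrimaryTorsion p, p • x = 0 → (∀ d ∈ decomp v, d • x = x) → x = 0)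
    (hq₂c : ∀ v : HeightOneSpectrum (𝓞 ℚ), ((q₂ : ℕ) : 𝓞 ℚ) ∈ v.asIdeal →
      ∀ x : W.geomPrimaryTorsion p, p • x = 0 → (∀ d ∈ decomp v, d • x = x) → x = 0) :
    ∀ v : HeightOneSpectrum (𝓞 ℚ), ¬ W.HasGoodReductionAt v → ((p : ℕ) : 𝓞 ℚ) ∉ v.asIdeal →
      ∀ x : W.geomPrimaryTorsion p, p • x = 0 → (∀ d ∈ decomp v, d • x = x) → x = 0 := by
  have hp : p.Prime := Fact.out
  intro v hbad hpv x hx hfix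
  haveI := Fact.mk (primesEquiv v).2
  have hℓ : ((primesEquiv v : Nat.Primes) : ℕ).Prime := (primesEquiv v).2
  have hΔ : (((primesEquiv v : Nat.Primes) : ℕ) : ℤ) ∣ minimalDiscriminantInt W := by
    by_contra hnd
    exact hbad ((hasGoodReductionAtPrime_iff_hasGoodReductionAt_ringOfIntegers v W).mp
      (hasGoodReductionAtPrime_of_not_dvd W _ hnd))
  have hℓZ : Prime ((((primesEquiv v : Nat.Primes) : ℕ) : ℤ)) := Nat.prime_iff_prime_int.mp hℓ
  -- the clause at a place above a displayed prime `q`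
  have key : ∀ {q : ℕ} (hq : q.Prime) {c : ℕ}, (((primesEquiv v : Nat.Primes) : ℕ) : ℤ) ∣ (q : ℤ) ^ c →
      (∀ w : HeightOneSpectrum (𝓞 ℚ), ((q : ℕ) : 𝓞 ℚ) ∈ w.asIdeal →
        ∀ y : W.geomPrimaryTorsion p, p • y = 0 → (∀ d ∈ decomp w, d • y = y) → y = 0) → x = 0 := by
    intro q hq c h hqc
    have h1 : ((primesEquiv v : Nat.Primes) : ℕ) ∣ q := Int.natCast_dvd_natCast.mp (hℓZ.dvd_of_dvd_pow h)
    have h2 : primesEquiv v = ⟨q, hq⟩ := Subtype.ext ((Nat.prime_dvd_prime_iff_eq hℓ hq).mp h1)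
    exact hqc v ((natCast_mem_asIdeal_iff_eq_primesEquiv_symm v hq).mpr ((Equiv.eq_symm_apply _).mpr h2)) x hx hfix
  rcases hℓZ.dvd_or_dvd (hΔ.trans hrad) with h | h
  · rcases hℓZ.dvd_or_dvd h with h' | h'
    · rcases hℓZ.dvd_or_dvd h' with h'' | h''
      · exfalso
        have h1 : ((primesEquiv v : Nat.Primes) : ℕ) ∣ p := Int.natCast_dvd_natCast.mp (hℓZ.dvd_of_dvd_pow h'')
        have h2 : primesEquiv v = ⟨p, hp⟩ := Subtype.ext ((Nat.prime_dvd_prime_iff_eq hℓ hp).mp h1)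
        exact hpv ((natCast_mem_asIdeal_iff_eq_primesEquiv_symm v hp).mpr ((Equiv.eq_symm_apply _).mpr h2))
      · exact key hq₁ h'' hq₁c
    · exact key hq₂ h' hq₂c
  · exact W.geomPrimaryTorsion_eq_zero_of_decomp_fixed_of_hasAdditiveReductionAt
      (W.hasAdditiveReductionAt_of_dvd_of_dvd v hΔ (hℓZ.dvd_of_dvd_pow h)) hp hp5 hpv x hx hfix

/-- **(A) at `(E,p)` from the row's U₀ statement on a row with TWO multiplicative bad primes** (`p ≥ 5`): as
`conjAAt_of_missingUpperBoundAt_of_padic_of_prime` with both clauses displayed. NOT a road to U₀. [cite: CoatesSujatha2005, §3 statement (A)]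
[cite: RaySujatha2021, Cor. 2.7 (arXiv:2112.13335 p. 6)] [cite: DeoRaySujatha2023, Thm. 3.9 (c3)] [cite: Miller2011LMS, Def. 1.1] -/
theorem conjAAt_of_missingUpperBoundAt_of_padic_of_two_primes (hGZK : rank_eq_analyticRank_of_analyticRank_le_one)
    {p : ℕ} [Fact p.Prime] (hp5 : 5 ≤ p) (hr : W.analyticRank = 0) (hirr : W.HasIrreducibleModPGaloisRep p)
    (hU : MissingUpperBoundAt W p) {s : ℚ} (hs : shaAn W = (s : ℂ)) (hsv : padicValRat p s ≤ 0)
    {q₁ q₂ : ℕ} (hq₁ : q₁.Prime) (hq₂ : q₂.Prime) {a b c₁ c₂ : ℕ}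
    (hrad : minimalDiscriminantInt W ∣ (p : ℤ) ^ a * (q₁ : ℤ) ^ c₁ * (q₂ : ℤ) ^ c₂ * (integralModelInt W).c₄ ^ b)
    (hq₁c : ∀ v : HeightOneSpectrum (𝓞 ℚ), ((q₁ : ℕ) : 𝓞 ℚ) ∈ v.asIdeal →
      ∀ x : W.geomPrimaryTorsion p, p • x = 0 → (∀ d ∈ decomp v, d • x = x) → x = 0)
    (hq₂c : ∀ v : HeightOneSpectrum (𝓞 ℚ), ((q₂ : ℕ) : 𝓞 ℚ) ∈ v.asIdeal →
      ∀ x : W.geomPrimaryTorsion p, p • x = 0 → (∀ d ∈ decomp v, d • x = x) → x = 0)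
    (hQp : ∀ Q : (W.baseChange ℚ_[p]).toAffine.Point, p • Q = 0 → Q = 0) :
    Rank1Residual.ConjAAt W p :=
  conjAAt_of_missingUpperBoundAt_of_padic_of_away W hGZK (by omega) hr hirr hU hs hsv
    (hbad_of_dvd_pow_mul_pow_mul_pow_mul_pow W hp5 hq₁ hq₂ hrad hq₁c hq₂c) hQp

end Summit.BirchSwinnertonDyer.BirchSwinnertonDyer.Theorems.TameFineSelmerTrivialRoad

end
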